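import Literature.Probability.RandomPlanarGeometry.HexSAWSurfaceWallRenewalEleventhCensusIdentity
import Literature.Probability.RandomPlanarGeometry.HexSAWSurfaceWallRenewalCensusElevenA
import Literature.Probability.RandomPlanarGeometry.HexSAWSurfaceWallRenewalCensusElevenB2
import Literature.Probability.RandomPlanarGeometry.HexSAWSurfaceWallRenewalCensusElevenC3
import Literature.Probability.RandomPlanarGeometry.HexSAWSurfaceWallRenewalSlackTwoClassification
import HarnessLib

/-!
# The eleventh-order coefficient of `β(y)²` is minus sixteen:
# `y¹⁰ (β(y)² − y − 1/y − 1/y² − 2/y³ − 4/y⁴ − 6/y⁵ − 12/y⁶ − 18/y⁷ − 15/y⁸ − 7/y⁹) → −16`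

`β(y) = wallRate y` is the exponential growth rate of wall bridges of self-avoiding walks on the brick-wall (hexagonal) lattice along a zigzag wall with
contact fugacity `y`.  «ELEVENTH-CENSUS-IDENTITY» identifies the eleventh coefficient with `N₁₂,₁ + N₁₃,₂ + N₁₄,₃ + N₁₅,₄ + N₁₆,₅ − 6783`; this module substitutes
`2085`, `2579` («CENSUS-ELEVEN-A»), `1585` («CENSUS-ELEVEN-B1/B2»), `486` («CENSUS-ELEVEN-C1/C2/C3») — this seat's counting engine — and `N₁₆,₅ = 32` from a-idea-1's
slack-two classification (car 74b-β, #803, `card_filter_visits_eq_slack_two` at `k = 5`: `2 + 0 + 1 + 4 + 9 + 16`):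

  ★★★ `tendsto_pow_ten_mul_wallRate_sq_sub : y¹⁰ (β(y)² − y − … − 15/y⁸ − 7/y⁹) → −16` (`y → ∞`),

i.e. **`β(y)² = y + 1/y + 1/y² + 2/y³ + 4/y⁴ + 6/y⁵ + 12/y⁶ + 18/y⁷ + 15/y⁸ + 7/y⁹ − 16/y¹⁰ + o(y⁻¹⁰)`** — THE FIRST NEGATIVE COEFFICIENT of the strong-adsorption
expansion (`isLittleO_wallRate_sq_sub_eleventh`, `eventually_eleventh_order_window`, `tendsto_pow_ten_mul_wallRate_sq_sub_unique`, `eleventh_coefficient_neg`).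
FIRST-A a-ref-2 g58's independent formal-series inversion (INBOX 2026-08-27T09:00:56Z) predicted exactly `a₁₀ = −16`.

HONEST LABEL.  LANE THEOREM, DERIVED (one-line assembly); NEW IN WRITING (modest).  Print: `β ∼ √y` ([BeatonBousquetMelouDeGierDuminilCopinGuttmann2014, §3.1, Proposition 5, p. 10]),
renewal structure ([MadrasSlade1993, §4.2], [Kesten1963SAW, §4]).  NOT CLAIMED: `a₁₁`, any rate, anything for `y ≤ μ³`.  No definitions.
-/

namespace Literature.Probability.RandomPlanarGeometry.SAW.HexBW.Wall

open Finset Filter Function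
open Literature.Probability.LatticeModels
open _root_.Topology Asymptotics

variable {y : ℝ}

/-- [folklore] Relabel the limit of a `Tendsto` by an equal constant. -/
private theorem tendsto_of_tendsto_of_eq_ux {f : ℝ → ℝ} {L c : ℝ} (h : Tendsto f atTop (𝓝 L)) (e : L = c) :
    Tendsto f atTop (𝓝 c) := e ▸ h

/-- ★★★ **THE ELEVENTH-ORDER COEFFICIENT OF `β(y)²` IS MINUS SIXTEEN:**
`y¹⁰ (β(y)² − y − … − 15/y⁸ − 7/y⁹) → −16` as `y → ∞` — the census identity with `2085 + 2579 + 1585 + 486 + 32 = 6767` and `6767 − 6783 = −16`. [cite: BeatonBousquetMelouDeGierDuminilCopinGuttmann2014, Section 3.1, Proposition 5 (arXiv v5 p. 9); p. 10] [cite: Kesten1963SAW, Section 4] [cite: MadrasSlade1993, Section 4.2, (4.2.4), Theorem 4.2.2 (pp. 91–92)] -/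
theorem tendsto_pow_ten_mul_wallRate_sq_sub :
    Tendsto (fun y : ℝ => y ^ 10 * (wallRate y ^ 2 - y - 1 / y - 1 / y ^ 2 - 2 / y ^ 3 - 4 / y ^ 4 - 6 / y ^ 5 - 12 / y ^ 6 - 18 / y ^ 7 - 15 / y ^ 8 - 7 / y ^ 9))
      atTop (𝓝 (-16)) := by
  classical
  have h := tendsto_pow_ten_mul_wallRate_sq_sub_census (m₁ := 24) (m₂ := 26) (m₃ := 28) (m₄ := 30) (m₅ := 32) rfl rfl rfl rfl rfl
  have h5 : #((ipwb 32).filter fun ω => visits 32 ω = 5) = 32 := by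
    rw [card_filter_visits_eq_slack_two (k := 5) (by norm_num) rfl]; decide
  rw [card_oneVisit_ipwb_twentyfour_eq rfl, card_twoVisit_ipwb_twentysix_eq rfl, card_threeVisit_ipwb_twentyeight_eq rfl,
    card_fourVisit_ipwb_thirty_eq rfl, h5] at h
  exact tendsto_of_tendsto_of_eq_ux h (by norm_num)

/-- ★★★ Landau form: `β(y)² − (y + 1/y + … + 15/y⁸ + 7/y⁹ − 16/y¹⁰) = o(y⁻¹⁰)` as `y → ∞`.
[cite: BeatonBousquetMelouDeGierDuminilCopinGuttmann2014, Section 3.1, Proposition 5 (arXiv v5 p. 9)] -/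
theorem isLittleO_wallRate_sq_sub_eleventh :
    (fun y : ℝ => wallRate y ^ 2 - (y + 1 / y + 1 / y ^ 2 + 2 / y ^ 3 + 4 / y ^ 4 + 6 / y ^ 5 + 12 / y ^ 6 + 18 / y ^ 7 + 15 / y ^ 8 + 7 / y ^ 9 - 16 / y ^ 10)) =o[atTop]
      fun y : ℝ => 1 / y ^ 10 := by
  have h0 : Tendsto (fun y : ℝ => y ^ 10 * (wallRate y ^ 2 - y - 1 / y - 1 / y ^ 2 - 2 / y ^ 3 - 4 / y ^ 4 - 6 / y ^ 5 - 12 / y ^ 6 - 18 / y ^ 7 - 15 / y ^ 8 - 7 / y ^ 9) - (-16))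
      atTop (𝓝 0) := by
    simpa using tendsto_pow_ten_mul_wallRate_sq_sub.sub_const (-16)
  have h1 : (fun y : ℝ => y ^ 10 * (wallRate y ^ 2 - y - 1 / y - 1 / y ^ 2 - 2 / y ^ 3 - 4 / y ^ 4 - 6 / y ^ 5 - 12 / y ^ 6 - 18 / y ^ 7 - 15 / y ^ 8 - 7 / y ^ 9) - (-16)) =o[atTop]
      fun _ : ℝ => (1 : ℝ) := (isLittleO_one_iff ℝ).2 h0
  have h2 := h1.mul_isBigO (isBigO_refl (fun y : ℝ => 1 / y ^ 10) atTop)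
  refine (h2.congr' ?_ ?_)
  · filter_upwards [eventually_gt_atTop (0 : ℝ)] with y hy
    field_simp
    ring
  · exact Eventually.of_forall fun y => by simp

/-- ★★ Two-sided eventual form: for every `δ > 0`, eventually
`y + 1/y + … + 7/y⁹ + (−16 − δ)/y¹⁰ ≤ β(y)² ≤ y + 1/y + … + 7/y⁹ + (−16 + δ)/y¹⁰`.
[cite: BeatonBousquetMelouDeGierDuminilCopinGuttmann2014, Section 3.1, Proposition 5 (arXiv v5 p. 9)] -/
theorem eventually_eleventh_order_window {δ : ℝ} (hδ : 0 < δ) :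
    ∀ᶠ y : ℝ in atTop, y + 1 / y + 1 / y ^ 2 + 2 / y ^ 3 + 4 / y ^ 4 + 6 / y ^ 5 + 12 / y ^ 6 + 18 / y ^ 7 + 15 / y ^ 8 + 7 / y ^ 9 + (-16 - δ) / y ^ 10 ≤ wallRate y ^ 2 ∧
      wallRate y ^ 2 ≤ y + 1 / y + 1 / y ^ 2 + 2 / y ^ 3 + 4 / y ^ 4 + 6 / y ^ 5 + 12 / y ^ 6 + 18 / y ^ 7 + 15 / y ^ 8 + 7 / y ^ 9 + (-16 + δ) / y ^ 10 := by
  have h := tendsto_pow_ten_mul_wallRate_sq_sub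
  have hlo := h.eventually (eventually_gt_nhds (show (-16 : ℝ) - δ < -16 by linarith))
  have hhi := h.eventually (eventually_lt_nhds (show (-16 : ℝ) < -16 + δ by linarith))
  filter_upwards [hlo, hhi, eventually_gt_atTop (0 : ℝ)] with y h1 h2 hy
  have hy8 : 0 < y ^ 10 := pow_pos hy 10
  have e2 : wallRate y ^ 2 = (y + 1 / y + 1 / y ^ 2 + 2 / y ^ 3 + 4 / y ^ 4 + 6 / y ^ 5 + 12 / y ^ 6 + 18 / y ^ 7 + 15 / y ^ 8 + 7 / y ^ 9) +
      (y ^ 10 * (wallRate y ^ 2 - y - 1 / y - 1 / y ^ 2 - 2 / y ^ 3 - 4 / y ^ 4 - 6 / y ^ 5 - 12 / y ^ 6 - 18 / y ^ 7 - 15 / y ^ 8 - 7 / y ^ 9)) / y ^ 10 := by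
    field_simp
    ring
  have elo : y + 1 / y + 1 / y ^ 2 + 2 / y ^ 3 + 4 / y ^ 4 + 6 / y ^ 5 + 12 / y ^ 6 + 18 / y ^ 7 + 15 / y ^ 8 + 7 / y ^ 9 + (-16 - δ) / y ^ 10 =
      (y + 1 / y + 1 / y ^ 2 + 2 / y ^ 3 + 4 / y ^ 4 + 6 / y ^ 5 + 12 / y ^ 6 + 18 / y ^ 7 + 15 / y ^ 8 + 7 / y ^ 9) + (-16 - δ) / y ^ 10 := by ring
  have ehi : y + 1 / y + 1 / y ^ 2 + 2 / y ^ 3 + 4 / y ^ 4 + 6 / y ^ 5 + 12 / y ^ 6 + 18 / y ^ 7 + 15 / y ^ 8 + 7 / y ^ 9 + (-16 + δ) / y ^ 10 =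
      (y + 1 / y + 1 / y ^ 2 + 2 / y ^ 3 + 4 / y ^ 4 + 6 / y ^ 5 + 12 / y ^ 6 + 18 / y ^ 7 + 15 / y ^ 8 + 7 / y ^ 9) + (-16 + δ) / y ^ 10 := by ring
  rw [elo, ehi, e2]
  constructor
  · gcongr
  · gcongr

/-- ★ Uniqueness form: any limit of `y¹⁰ (β(y)² − y − … − 7/y⁹)` equals `−16`. [cite: MadrasSlade1993, Section 4.2, Theorem 4.2.2 (pp. 91–92)] -/
theorem tendsto_pow_ten_mul_wallRate_sq_sub_unique {L : ℝ}
    (h : Tendsto (fun y : ℝ => y ^ 10 * (wallRate y ^ 2 - y - 1 / y - 1 / y ^ 2 - 2 / y ^ 3 - 4 / y ^ 4 - 6 / y ^ 5 - 12 / y ^ 6 - 18 / y ^ 7 - 15 / y ^ 8 - 7 / y ^ 9))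
      atTop (𝓝 L)) :
    L = -16 :=
  tendsto_nhds_unique h tendsto_pow_ten_mul_wallRate_sq_sub

/-- ★★ **The strong-adsorption expansion has a NEGATIVE coefficient**: any limit of `y¹⁰ (β² − y − … − 7/y⁹)` is `< 0`
(sequence `1, 1, 2, 4, 6, 12, 18, 15, 7, −16`). [cite: BeatonBousquetMelouDeGierDuminilCopinGuttmann2014, Section 3.1, Proposition 5 (arXiv v5 p. 9); p. 10] -/
theorem eleventh_coefficient_neg {L : ℝ}
    (h : Tendsto (fun y : ℝ => y ^ 10 * (wallRate y ^ 2 - y - 1 / y - 1 / y ^ 2 - 2 / y ^ 3 - 4 / y ^ 4 - 6 / y ^ 5 - 12 / y ^ 6 - 18 / y ^ 7 - 15 / y ^ 8 - 7 / y ^ 9))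
      atTop (𝓝 L)) : L < 0 := by
  rw [tendsto_pow_ten_mul_wallRate_sq_sub_unique h]
  norm_num

end Literature.Probability.RandomPlanarGeometry.SAW.HexBW.Wall
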